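import Summits.NavierStokesRegularity.NavierStokesRegularity.Theorems.PoloidalWindowDoorPoloidalWindowRigidityZShockLoadedCharacteristics
import Summits.NavierStokesRegularity.NavierStokesRegularity.Theorems.PoloidalWindowDoorPoloidalWindowRigidityZShockOneEndedTools
import HarnessLib

/-!
# Crux K2 `PoloidalWindowRigidity` (stmt-NavierStokesRegularity-19708), line `z_shock` — R2 WITHOUT SIGN HYPOTHESIS FOR RIEMANN-TYPE
# DATA: no two-sided solution connects end states at `x = ±∞` when `κ'` has one strict sign at the right state and at the middle state

`--supports stmt-NavierStokesRegularity-19708 --as helper` (leafhand-ns-poloidalwindowdoor-3 g3, cell decomp-ns, 2026-08-31).  Class-free,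
Mathlib + tree files only.  **No stub and no summit is closed by this file; Navier–Stokes regularity is NOT proved here (rung 0).**

`pSystem_const_of_two_states` — let `(w, p) ∈ C²` solve the autonomous p-system `p_z = −κ(w)² w_x`, `w_z = −p_x` on `ℝ × ℝ`
(two-sided), with `0 < κlo ≤ κ(w) ≤ κhi`, `|κ'(w)| ≤ k₁`, `|w| ≤ Mw`, `|w_x| ≤ W₁` along the solution, `κ > 0`, `κ ∈ C¹` nowhere linearly
degenerate, NO sign hypothesis on `κ'`.  Suppose that on the slice `z = 0` the backward invariant `s = p − K(w)` tends to `s₊` as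
`x → +∞` and to `s₋` as `x → −∞` (possibly DIFFERENT), and the forward invariant `r = p + K(w)` tends to `r₊` as `x → +∞`.  Let `w₊`
(the right end state) and `vm` (the «middle state» of the associated Riemann problem) be given by `K(w₊) = (r₊ − s₊)/2`,
`K(vm) = (r₊ − s₋)/2`.  If `κ'(w₊) · κ'(vm) > 0`, the solution is constant (so in fact `s₊ = s₋`: a two-sided smooth solution cannot
connect different end states through a middle state of the same strict genuine-nonlinearity sign as the right state).
`…ZShockQuietInvariant` (p823749) is the case `s₊ = s₋` (there with NO condition at all, by interval filling); the three reflected variants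
(`r` quiet at `−∞`; roles of `r`/`s` exchanged) follow by the symmetries `(z,x) ↦ (−z,−x)` and `x ↦ −x, p ↦ −p` and are not spelled out.

Proof.  Along a loaded forward characteristic `X` from `(0, x₀)` John's weighted gradient `q` obeys `q' = −G(w∘X) q²`
(`…LoadedCharacteristics.johnGradient_hasDerivAt`), and by domain of dependence `w∘X → v₊(x₀)`, `K(v₊) = (r(0,x₀) − s₊)/2` as
`z → +∞`, `w∘X → v₋(x₀)`, `K(v₋) = (r(0,x₀) − s₋)/2` as `z → −∞`.  The one-ended sign lemmas (`…OneEndedTools`) give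
`sign r_x(0,x₀) = sign κ'(v₊) = −sign κ'(v₋)` when these are nonzero, so `κ'(v₊(x₀)) κ'(v₋(x₀)) ≤ 0` at every loaded point
(`loaded_sign_constraint`).  When `r(0, x₀)` is close to `r₊`, `(v₊, v₋)` is close to `(w₊, vm)` where the product is `> 0`: such points
are not loaded.  Hence `r(0,·)` is constant (`= r₊`) near `+∞`, and the set `{x | r(0,·) = r₊ on [x,∞)}` is non-empty, closed and open,
so it is `ℝ`; then `r ≡ r₊` on `ℝ × ℝ` and `…ScalarEternal.pSystem_const_of_forward_flat` finishes. [folklore]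
-/

noncomputable section

namespace Summit.NavierStokesRegularity.NavierStokesRegularity.Theorems.PoloidalWindowDoorPoloidalWindowRigidityZShockTwoStates

-- the summit and its single sub-problem share the name (CONVENTIONS §1)
set_option linter.dupNamespace false

open Set Filter Topology Function Metric
open Summit.NavierStokesRegularity.NavierStokesRegularity.Theorems.PoloidalWindowDoorPoloidalWindowRigidityZShockCharacteristicRiccati
open Summit.NavierStokesRegularity.NavierStokesRegularity.Theorems.PoloidalWindowDoorPoloidalWindowRigidityZShockPSystemNonuniform
open Summit.NavierStokesRegularity.NavierStokesRegularity.Theorems.PoloidalWindowDoorPoloidalWindowRigidityZShockScalarEternal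
open Summit.NavierStokesRegularity.NavierStokesRegularity.Theorems.PoloidalWindowDoorPoloidalWindowRigidityZShockQuietTools
open Summit.NavierStokesRegularity.NavierStokesRegularity.Theorems.PoloidalWindowDoorPoloidalWindowRigidityZShockLoadedCharacteristics
open Summit.NavierStokesRegularity.NavierStokesRegularity.Theorems.PoloidalWindowDoorPoloidalWindowRigidityZShockOneEndedTools

variable {w p : ℝ × ℝ → ℝ} {κ κ' K : ℝ → ℝ} {κlo κhi k₁ W₁ Mw sp sm rp wp vm : ℝ}

/-- **Sign constraint at a loaded point.**  Under the standing hypotheses, with `s(0,·) → s₊` at `+∞` and `→ s₋` at `−∞`: if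
`r_x(0, x₀) ≠ 0` then there are `v₊, v₋` (`|v±| ≤ Mw` not recorded) with `K(v₊) = (r(0,x₀) − s₊)/2`, `K(v₋) = (r(0,x₀) − s₋)/2` and
`κ'(v₊) κ'(v₋) ≤ 0`. [folklore] -/
theorem loaded_sign_constraint (hw : ContDiff ℝ 2 w) (hp : ContDiff ℝ 2 p)
    (hK2 : ContDiff ℝ 2 K) (hKd : ∀ v, HasDerivAt K (κ v) v) (hκd : ∀ v, HasDerivAt κ (κ' v) v) (hκ'c : Continuous κ')
    (hsys1 : ∀ q, fderiv ℝ p q (1, 0) = -(κ (w q) ^ 2 * fderiv ℝ w q (0, 1)))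
    (hsys2 : ∀ q, fderiv ℝ w q (1, 0) = -fderiv ℝ p q (0, 1))
    (hκlo0 : 0 < κlo) (hκlo : ∀ q, κlo ≤ κ (w q)) (hκhi : ∀ q, κ (w q) ≤ κhi) (hκpos : ∀ v, 0 < κ v)
    (hk₁ : ∀ q, |κ' (w q)| ≤ k₁) (hW₁ : ∀ q, |fderiv ℝ w q (0, 1)| ≤ W₁) (hMw : ∀ q, |w q| ≤ Mw)
    (hsTop : Tendsto (fun x : ℝ => p (0, x) - K (w (0, x))) atTop (𝓝 sp))
    (hsBot : Tendsto (fun x : ℝ => p (0, x) - K (w (0, x))) atBot (𝓝 sm)) {x₀ : ℝ}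
    (hα0 : fderiv ℝ p (0, x₀) (0, 1) + κ (w (0, x₀)) * fderiv ℝ w (0, x₀) (0, 1) ≠ 0) :
    ∃ vp vn : ℝ, K vp = (p (0, x₀) + K (w (0, x₀)) - sp) / 2 ∧ K vn = (p (0, x₀) + K (w (0, x₀)) - sm) / 2 ∧
      κ' vp * κ' vn ≤ 0 := by
  have hw1 : Differentiable ℝ w := hw.differentiable (by simp)
  have hp1 : Differentiable ℝ p := hp.differentiable (by simp)
  have hKc : Continuous K := hK2.continuous
  have hκc : Continuous κ := continuous_iff_continuousAt.2 fun v => (hκd v).continuousAt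
  have hKmono : StrictMono K := strictMono_of_deriv_pos fun v => by rw [(hKd v).deriv]; exact hκpos v
  have hκB : ∀ q, |κ (w q)| ≤ κhi := fun q => by rw [abs_of_pos (hκpos _)]; exact hκhi q
  -- Riemann invariants and the two transport equations
  set r : ℝ × ℝ → ℝ := fun q => p q + K (w q) with hrdef
  set s : ℝ × ℝ → ℝ := fun q => p q - K (w q) with hsdef
  have hr1 : Differentiable ℝ r := (hp.add (hK2.comp hw)).differentiable (by simp)
  have hKw : ∀ q, HasFDerivAt (fun q' => K (w q')) (κ (w q) • fderiv ℝ w q) q :=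
    fun q => (hKd (w q)).comp_hasFDerivAt q (hw1 q).hasFDerivAt
  have hrF : ∀ q, HasFDerivAt r (fderiv ℝ p q + κ (w q) • fderiv ℝ w q) q :=
    fun q => (hp1 q).hasFDerivAt.add (hKw q)
  have hsF : ∀ q, HasFDerivAt s (fderiv ℝ p q - κ (w q) • fderiv ℝ w q) q :=
    fun q => (hp1 q).hasFDerivAt.sub (hKw q)
  have hs1 : Differentiable ℝ s := fun q => (hsF q).differentiableAt
  have hrD : ∀ q v, fderiv ℝ r q v = fderiv ℝ p q v + κ (w q) * fderiv ℝ w q v := by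
    intro q v; rw [(hrF q).fderiv]; simp [smul_eq_mul]
  have hsD : ∀ q v, fderiv ℝ s q v = fderiv ℝ p q v - κ (w q) * fderiv ℝ w q v := by
    intro q v; rw [(hsF q).fderiv]; simp [smul_eq_mul]
  have hPDE1 : ∀ q, fderiv ℝ r q (1, 0) + (fun q => κ (w q)) q * fderiv ℝ r q (0, 1) = 0 := by
    intro q; simp only; rw [hrD, hrD, hsys1, hsys2]; ring
  have hPDE2 : ∀ q, fderiv ℝ s q (1, 0) + (fun q => -κ (w q)) q * fderiv ℝ s q (0, 1) = 0 := by
    intro q; simp only; rw [hsD, hsD, hsys1, hsys2]; ring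
  have hκd' : ∀ v, HasDerivAt (fun v => -κ v) ((fun v => -κ' v) v) v := fun v => (hκd v).neg
  have hκB' : ∀ q, |(fun v => -κ v) (w q)| ≤ κhi := fun q => by simp only [abs_neg]; exact hκB q
  have hk₁' : ∀ q, |(fun v => -κ' v) (w q)| ≤ k₁ := fun q => by simp only [abs_neg]; exact hk₁ q
  -- domain of dependence for `s`, pointwise form
  have hsA : ∀ z x : ℝ, ∃ y : ℝ, s (z, x) = s (0, y) ∧ (0 ≤ z → x + κlo * z ≤ y) ∧ (z ≤ 0 → y ≤ x + κlo * z) := by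
    intro z x
    obtain ⟨Y, hY0, hY⟩ := exists_global_char (c := fun v => -κ v) hw1 hκd' hκB' hk₁' hW₁ z x
    have hYd : Differentiable ℝ Y := fun t => (hY t).differentiableAt
    have hYle : ∀ t, deriv Y t ≤ -κlo := fun t => by rw [(hY t).deriv]; linarith [hκlo (t, Y t)]
    refine ⟨Y 0, ?_, fun hz => ?_, fun hz => ?_⟩
    · have h := const_along (c := fun q => -κ (w q)) hs1 hPDE2 hY z 0
      rwa [hY0] at h
    · have h := image_sub_le_mul_sub_of_deriv_le hYd hYle hz
      rw [hY0] at h; nlinarith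
    · have h := image_sub_le_mul_sub_of_deriv_le hYd hYle hz
      rw [hY0] at h; nlinarith
  choose y hy using hsA
  -- the forward characteristic from `(0, x₀)`
  obtain ⟨X, hX0, hX⟩ := exists_global_char hw1 hκd hκB hk₁ hW₁ 0 x₀
  have hXd : Differentiable ℝ X := fun t => (hX t).differentiableAt
  have hXge : ∀ t, κlo ≤ deriv X t := fun t => by rw [(hX t).deriv]; exact hκlo (t, X t)
  have hrX : ∀ z, r (z, X z) = r (0, x₀) := fun z => by
    have h := const_along (c := fun q => κ (w q)) hr1 hPDE1 hX z 0
    rwa [hX0] at h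
  have hXfwd : ∀ z, 0 ≤ z → x₀ + κlo * z ≤ X z := fun z hz => by
    have h := mul_sub_le_image_sub_of_le_deriv hXd hXge hz
    rw [hX0] at h; linarith
  have hXbwd : ∀ z, z ≤ 0 → X z ≤ x₀ + κlo * z := fun z hz => by
    have h := mul_sub_le_image_sub_of_le_deriv hXd hXge hz
    rw [hX0] at h; linarith
  have hytop : Tendsto (fun z => y z (X z)) atTop atTop := by
    refine tendsto_atTop_atTop.2 fun b => ⟨max 0 ((b - x₀) / (2 * κlo)), fun z hz => ?_⟩
    have hz0 : 0 ≤ z := le_trans (le_max_left _ _) hz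
    have hz1 : (b - x₀) / (2 * κlo) ≤ z := le_trans (le_max_right _ _) hz
    rw [div_le_iff₀ (by positivity)] at hz1
    linarith [(hy z (X z)).2.1 hz0, hXfwd z hz0]
  have hybot : Tendsto (fun z => y z (X z)) atBot atBot := by
    refine tendsto_atBot_atBot.2 fun b => ⟨min 0 ((b - x₀) / (2 * κlo)), fun z hz => ?_⟩
    have hz0 : z ≤ 0 := le_trans hz (min_le_left _ _)
    have hz1 : z ≤ (b - x₀) / (2 * κlo) := le_trans hz (min_le_right _ _)
    rw [le_div_iff₀ (by positivity)] at hz1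
    linarith [(hy z (X z)).2.2 hz0, hXbwd z hz0]
  have hsXtop : Tendsto (fun z => s (z, X z)) atTop (𝓝 sp) := by
    refine Tendsto.congr (fun z => ?_) (hsTop.comp hytop)
    exact ((hy z (X z)).1).symm
  have hsXbot : Tendsto (fun z => s (z, X z)) atBot (𝓝 sm) := by
    refine Tendsto.congr (fun z => ?_) (hsBot.comp hybot)
    exact ((hy z (X z)).1).symm
  -- limits of `w ∘ X` at the two ends
  have hKwX : ∀ z, K (w (z, X z)) = (r (0, x₀) - s (z, X z)) / 2 := fun z => by
    have h := hrX z
    simp only [hrdef, hsdef] at h ⊢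
    linarith
  have hKXtop : Tendsto (fun z => K (w (z, X z))) atTop (𝓝 ((r (0, x₀) - sp) / 2)) := by
    have h := ((tendsto_const_nhds (x := r (0, x₀))).sub hsXtop).div_const 2
    exact h.congr fun z => (hKwX z).symm
  have hKXbot : Tendsto (fun z => K (w (z, X z))) atBot (𝓝 ((r (0, x₀) - sm) / 2)) := by
    have h := ((tendsto_const_nhds (x := r (0, x₀))).sub hsXbot).div_const 2
    exact h.congr fun z => (hKwX z).symm
  obtain ⟨vp, hKvp, hwXtop⟩ :=
    exists_lim_of_tendsto_strictMono (f := fun z => w (z, X z)) hKc hKmono (fun z => hMw (z, X z)) hKXtop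
  obtain ⟨vn, hKvn, hwXbot⟩ :=
    exists_lim_of_tendsto_strictMono (f := fun z => w (z, X z)) hKc hKmono (fun z => hMw (z, X z)) hKXbot
  refine ⟨vp, vn, hKvp, hKvn, ?_⟩
  -- John's weighted gradient along `X` and the limits of its coefficient
  have hq := johnGradient_hasDerivAt hw hp hK2 hKd hκd hsys1 hsys2 hκpos hX
  have h0' : fderiv ℝ p (0, X 0) (0, 1) + κ (w (0, X 0)) * fderiv ℝ w (0, X 0) (0, 1) ≠ 0 := by rwa [hX0]
  have hα := forwardGradient_ne_zero hw hp hK2 hKd hκd hsys1 hsys2 hk₁ hW₁ hX h0'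
  have hqne : ∀ z, Real.exp (Real.log (κ (w (z, X z))) / 2) *
      (fderiv ℝ p (z, X z) (0, 1) + κ (w (z, X z)) * fderiv ℝ w (z, X z) (0, 1)) ≠ 0 :=
    fun z => mul_ne_zero (Real.exp_pos _).ne' (hα z)
  set G : ℝ → ℝ := fun u => κ' u / (2 * κ u) * Real.exp (-(Real.log (κ u) / 2)) with hG
  have hGc : ∀ v, ContinuousAt G v := fun v => by
    have hκv : κ v ≠ 0 := (hκpos v).ne'
    refine ContinuousAt.mul ?_ ?_
    · exact hκ'c.continuousAt.div (continuousAt_const.mul hκc.continuousAt) (mul_ne_zero two_ne_zero hκv)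
    · exact ((hκc.continuousAt.log hκv).div_const 2).neg.rexp
  have hGtop : Tendsto (fun z => G (w (z, X z))) atTop (𝓝 (G vp)) := (hGc vp).tendsto.comp hwXtop
  have hGbot : Tendsto (fun z => G (w (z, X z))) atBot (𝓝 (G vn)) := (hGc vn).tendsto.comp hwXbot
  -- `G` has the sign of `κ'`
  have hGsign : ∀ v, G v = κ' v * (Real.exp (-(Real.log (κ v) / 2)) / (2 * κ v)) := fun v => by
    simp only [hG]; ring
  have hGfac : ∀ v, 0 < Real.exp (-(Real.log (κ v) / 2)) / (2 * κ v) := fun v => by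
    have := hκpos v; positivity
  -- the four one-ended sign conclusions, evaluated at `z = 0`
  by_contra hprod
  push Not at hprod
  have hsame : (0 < κ' vp ∧ 0 < κ' vn) ∨ (κ' vp < 0 ∧ κ' vn < 0) := by
    rcases lt_trichotomy 0 (κ' vp) with h1 | h1 | h1
    · exact Or.inl ⟨h1, by nlinarith [hprod]⟩
    · exfalso; rw [← h1, zero_mul] at hprod; exact lt_irrefl _ hprod
    · exact Or.inr ⟨h1, by nlinarith [hprod]⟩
  rcases hsame with ⟨h1, h2⟩ | ⟨h1, h2⟩
  · have hGp : 0 < G vp := by rw [hGsign]; exact mul_pos h1 (hGfac vp)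
    have hGn : 0 < G vn := by rw [hGsign]; exact mul_pos h2 (hGfac vn)
    obtain ⟨T, hT⟩ := eventually_atTop.1 (hGtop.eventually_const_lt (show G vp / 2 < G vp by linarith))
    obtain ⟨S, hS⟩ := eventually_atBot.1 (hGbot.eventually_const_lt (show G vn / 2 < G vn by linarith))
    have hpos := riccati_pos_of_fwd_pos (b₀ := G vp / 2) hq hqne (by linarith) (fun z hz => (hT z hz).le) 0
    have hneg := riccati_neg_of_bwd_pos (b₀ := G vn / 2) hq hqne (by linarith) (fun z hz => (hS z hz).le) 0
    linarith
  · have hGp : G vp < 0 := by rw [hGsign]; exact mul_neg_of_neg_of_pos h1 (hGfac vp)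
    have hGn : G vn < 0 := by rw [hGsign]; exact mul_neg_of_neg_of_pos h2 (hGfac vn)
    obtain ⟨T, hT⟩ := eventually_atTop.1 (hGtop.eventually_lt_const (show G vp < G vp / 2 by linarith))
    obtain ⟨S, hS⟩ := eventually_atBot.1 (hGbot.eventually_lt_const (show G vn < G vn / 2 by linarith))
    have hneg := riccati_neg_of_fwd_neg (b₀ := -(G vp / 2)) hq hqne (by linarith)
      (fun z hz => by linarith [hT z hz]) 0
    have hpos := riccati_pos_of_bwd_neg (b₀ := -(G vn / 2)) hq hqne (by linarith)
      (fun z hz => by linarith [hS z hz]) 0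
    linarith

/-- **★ R2 without sign hypothesis, two end states** (hypotheses and proof in the module docstring). [folklore] -/
theorem pSystem_const_of_two_states (hw : ContDiff ℝ 2 w) (hp : ContDiff ℝ 2 p)
    (hK2 : ContDiff ℝ 2 K) (hKd : ∀ v, HasDerivAt K (κ v) v) (hκd : ∀ v, HasDerivAt κ (κ' v) v) (hκ'c : Continuous κ')
    (hsys1 : ∀ q, fderiv ℝ p q (1, 0) = -(κ (w q) ^ 2 * fderiv ℝ w q (0, 1)))
    (hsys2 : ∀ q, fderiv ℝ w q (1, 0) = -fderiv ℝ p q (0, 1))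
    (hκlo0 : 0 < κlo) (hκlo : ∀ q, κlo ≤ κ (w q)) (hκhi : ∀ q, κ (w q) ≤ κhi) (hκpos : ∀ v, 0 < κ v)
    (hgn : ∀ a b : ℝ, a < b → ∃ v ∈ Ioo a b, κ' v ≠ 0)
    (hk₁ : ∀ q, |κ' (w q)| ≤ k₁) (hW₁ : ∀ q, |fderiv ℝ w q (0, 1)| ≤ W₁) (hMw : ∀ q, |w q| ≤ Mw)
    (hsTop : Tendsto (fun x : ℝ => p (0, x) - K (w (0, x))) atTop (𝓝 sp))
    (hsBot : Tendsto (fun x : ℝ => p (0, x) - K (w (0, x))) atBot (𝓝 sm))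
    (hrTop : Tendsto (fun x : ℝ => p (0, x) + K (w (0, x))) atTop (𝓝 rp))
    (hwp : K wp = (rp - sp) / 2) (hvm : K vm = (rp - sm) / 2) (hsign : 0 < κ' wp * κ' vm) :
    ∀ q q' : ℝ × ℝ, w q = w q' ∧ p q = p q' := by
  have hw1 : Differentiable ℝ w := hw.differentiable (by simp)
  have hp1 : Differentiable ℝ p := hp.differentiable (by simp)
  have hKmono : StrictMono K := strictMono_of_deriv_pos fun v => by rw [(hKd v).deriv]; exact hκpos v
  have hκB : ∀ q, |κ (w q)| ≤ κhi := fun q => by rw [abs_of_pos (hκpos _)]; exact hκhi q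
  set r : ℝ × ℝ → ℝ := fun q => p q + K (w q) with hrdef
  have hr2 : ContDiff ℝ 2 r := hp.add (hK2.comp hw)
  have hr1 : Differentiable ℝ r := hr2.differentiable (by simp)
  have hKw : ∀ q, HasFDerivAt (fun q' => K (w q')) (κ (w q) • fderiv ℝ w q) q :=
    fun q => (hKd (w q)).comp_hasFDerivAt q (hw1 q).hasFDerivAt
  have hrF : ∀ q, HasFDerivAt r (fderiv ℝ p q + κ (w q) • fderiv ℝ w q) q :=
    fun q => (hp1 q).hasFDerivAt.add (hKw q)
  have hrD : ∀ q v, fderiv ℝ r q v = fderiv ℝ p q v + κ (w q) * fderiv ℝ w q v := by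
    intro q v; rw [(hrF q).fderiv]; simp [smul_eq_mul]
  have hPDE1 : ∀ q, fderiv ℝ r q (1, 0) + (fun q => κ (w q)) q * fderiv ℝ r q (0, 1) = 0 := by
    intro q; simp only; rw [hrD, hrD, hsys1, hsys2]; ring
  -- a neighbourhood of `(wp, vm)` where the product of the `κ'` is positive
  obtain ⟨δ, hδ, hδsign⟩ : ∃ δ > 0, ∀ u u' : ℝ, |u - wp| < δ → |u' - vm| < δ → 0 < κ' u * κ' u' := by
    have hc : ContinuousAt (fun uu : ℝ × ℝ => κ' uu.1 * κ' uu.2) (wp, vm) :=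
      (hκ'c.continuousAt.comp continuousAt_fst).mul (hκ'c.continuousAt.comp continuousAt_snd)
    have hev := hc.eventually (isOpen_Ioi.mem_nhds hsign)
    obtain ⟨δ, hδ, h⟩ := Metric.eventually_nhds_iff.1 hev
    refine ⟨δ, hδ, fun u u' hu hu' => @h (u, u') ?_⟩
    rw [Prod.dist_eq, Real.dist_eq, Real.dist_eq]
    exact max_lt hu hu'
  -- the slice `ρ(x) = r(0, x)`, its derivative, and: points with `ρ` close to `rp` are not loaded
  have hρd : ∀ x, HasDerivAt (fun y : ℝ => r (0, y)) (fderiv ℝ r (0, x) ((0 : ℝ), (1 : ℝ))) x := fun x =>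
    (hr1 (0, x)).hasFDerivAt.comp_hasDerivAt x ((hasDerivAt_const x (0 : ℝ)).prodMk (hasDerivAt_id x))
  have hρc : Continuous fun y : ℝ => r (0, y) := hr1.continuous.comp (continuous_const.prodMk continuous_id)
  set ε : ℝ := 2 * min (min (K (wp + δ) - K wp) (K wp - K (wp - δ))) (min (K (vm + δ) - K vm) (K vm - K (vm - δ))) with hε
  have hε0 : 0 < ε := by
    have h1 := hKmono (show wp < wp + δ by linarith); have h2 := hKmono (show wp - δ < wp by linarith)
    have h3 := hKmono (show vm < vm + δ by linarith); have h4 := hKmono (show vm - δ < vm by linarith)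
    rw [hε]
    refine mul_pos two_pos (lt_min (lt_min ?_ ?_) (lt_min ?_ ?_)) <;> linarith
  have hflat : ∀ x, |r (0, x) - rp| < ε → fderiv ℝ r (0, x) (0, 1) = 0 := by
    intro x hx
    by_contra hne
    have hne' : fderiv ℝ p (0, x) (0, 1) + κ (w (0, x)) * fderiv ℝ w (0, x) (0, 1) ≠ 0 := by rwa [← hrD]
    obtain ⟨vp, vn, hKvp, hKvn, hle⟩ := loaded_sign_constraint hw hp hK2 hKd hκd hκ'c hsys1 hsys2 hκlo0 hκlo hκhi hκpos
      hk₁ hW₁ hMw hsTop hsBot hne'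
    have hrx : p (0, x) + K (w (0, x)) = r (0, x) := rfl
    rw [hrx] at hKvp hKvn
    have hmin : ε / 2 ≤ K (wp + δ) - K wp ∧ ε / 2 ≤ K wp - K (wp - δ) ∧ ε / 2 ≤ K (vm + δ) - K vm ∧
        ε / 2 ≤ K vm - K (vm - δ) := by
      rw [hε]
      refine ⟨?_, ?_, ?_, ?_⟩ <;>
        nlinarith [min_le_left (min (K (wp + δ) - K wp) (K wp - K (wp - δ))) (min (K (vm + δ) - K vm) (K vm - K (vm - δ))),
          min_le_right (min (K (wp + δ) - K wp) (K wp - K (wp - δ))) (min (K (vm + δ) - K vm) (K vm - K (vm - δ))),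
          min_le_left (K (wp + δ) - K wp) (K wp - K (wp - δ)), min_le_right (K (wp + δ) - K wp) (K wp - K (wp - δ)),
          min_le_left (K (vm + δ) - K vm) (K vm - K (vm - δ)), min_le_right (K (vm + δ) - K vm) (K vm - K (vm - δ))]
    rw [abs_lt] at hx
    have hvp : |vp - wp| < δ := by
      rw [abs_lt]; constructor
      · have : K (wp - δ) < K vp := by rw [hKvp]; linarith [hmin.2.1]
        linarith [hKmono.lt_iff_lt.1 this]
      · have : K vp < K (wp + δ) := by rw [hKvp]; linarith [hmin.1]
        linarith [hKmono.lt_iff_lt.1 this]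
    have hvn : |vn - vm| < δ := by
      rw [abs_lt]; constructor
      · have : K (vm - δ) < K vn := by rw [hKvn]; linarith [hmin.2.2.2]
        linarith [hKmono.lt_iff_lt.1 this]
      · have : K vn < K (vm + δ) := by rw [hKvn]; linarith [hmin.2.2.1]
        linarith [hKmono.lt_iff_lt.1 this]
    exact absurd (hδsign vp vn hvp hvn) (not_lt.2 hle)
  -- local constancy: if `r(0,·) = rp` at `x` then `r(0,·) = rp` on a neighbourhood
  have hloc : ∀ x, r (0, x) = rp → ∃ η > 0, ∀ x', |x' - x| < η → r (0, x') = rp := by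
    intro x hx
    obtain ⟨η, hη, hball⟩ : ∃ η > 0, ∀ x', dist x' x < η → |r (0, x') - rp| < ε := by
      have hev : ∀ᶠ x' in 𝓝 x, |r (0, x') - rp| < ε := by
        have h := (hρc.continuousAt (x := x)).sub (continuousAt_const (y := rp))
        have h2 := h.norm.eventually_lt_const (show ‖r (0, x) - rp‖ < ε by rw [hx, sub_self, norm_zero]; exact hε0)
        simpa [Real.norm_eq_abs] using h2
      obtain ⟨η, hη, h⟩ := Metric.eventually_nhds_iff.1 hev
      exact ⟨η, hη, fun x' hx' => h hx'⟩
    refine ⟨η, hη, fun x' hx' => ?_⟩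
    rcases lt_trichotomy x' x with hlt | heq | hgt
    · obtain ⟨ξ, hξ, hξd⟩ := exists_hasDerivAt_eq_slope (fun y : ℝ => r (0, y))
        (fun t => fderiv ℝ r (0, t) (0, 1)) hlt hρc.continuousOn (fun t _ => hρd t)
      have hξ0 : fderiv ℝ r (0, ξ) (0, 1) = 0 := by
        apply hflat; apply hball
        rw [Real.dist_eq, abs_lt]; rw [abs_lt] at hx'; constructor <;> linarith [hξ.1, hξ.2]
      rw [hξ0, eq_comm, div_eq_zero_iff] at hξd
      rcases hξd with h | h
      · linarith
      · linarith
    · rw [heq, hx]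
    · obtain ⟨ξ, hξ, hξd⟩ := exists_hasDerivAt_eq_slope (fun y : ℝ => r (0, y))
        (fun t => fderiv ℝ r (0, t) (0, 1)) hgt hρc.continuousOn (fun t _ => hρd t)
      have hξ0 : fderiv ℝ r (0, ξ) (0, 1) = 0 := by
        apply hflat; apply hball
        rw [Real.dist_eq, abs_lt]; rw [abs_lt] at hx'; constructor <;> linarith [hξ.1, hξ.2]
      rw [hξ0, eq_comm, div_eq_zero_iff] at hξd
      rcases hξd with h | h
      · linarith
      · linarith
  -- the set where `r(0,·) = rp` is clopen and non-empty, hence everything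
  set Sset : Set ℝ := {x | r (0, x) = rp} with hSset
  have hclosed : IsClosed Sset := isClosed_eq hρc continuous_const
  have hopen : IsOpen Sset := by
    rw [Metric.isOpen_iff]
    intro x hx
    obtain ⟨η, hη, h⟩ := hloc x hx
    exact ⟨η, hη, fun x' hx' => h x' (by rwa [Metric.mem_ball, Real.dist_eq] at hx')⟩
  have hne : Sset.Nonempty := by
    -- near `+∞`, `|r(0,·) − rp| < ε`, so `r_x(0,·) = 0` there and `r(0,·)` is constant `= rp`
    obtain ⟨R₀, hR₀⟩ := Metric.tendsto_atTop.1 hrTop ε hε0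
    have hconst : ∀ x, R₀ ≤ x → r (0, x) = r (0, R₀) := by
      intro x hx
      rcases hx.eq_or_lt with h | h
      · rw [h]
      · obtain ⟨ξ, hξ, hξd⟩ := exists_hasDerivAt_eq_slope (fun y : ℝ => r (0, y))
          (fun t => fderiv ℝ r (0, t) (0, 1)) h hρc.continuousOn (fun t _ => hρd t)
        have hξ0 : fderiv ℝ r (0, ξ) (0, 1) = 0 := by
          apply hflat
          have := hR₀ ξ hξ.1.le
          rwa [Real.dist_eq] at this
        rw [hξ0, eq_comm, div_eq_zero_iff] at hξd
        rcases hξd with h' | h'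
        · linarith
        · linarith
    have hlim : Tendsto (fun x : ℝ => r (0, x)) atTop (𝓝 (r (0, R₀))) :=
      tendsto_const_nhds.congr' (by
        filter_upwards [eventually_ge_atTop R₀] with x hx using (hconst x hx).symm)
    exact ⟨R₀, tendsto_nhds_unique hlim hrTop⟩
  have huniv : Sset = univ := (isClopen_iff.1 ⟨hclosed, hopen⟩).resolve_left hne.ne_empty
  have hρ : ∀ x, r (0, x) = rp := fun x => by
    have : x ∈ Sset := by rw [huniv]; exact mem_univ x
    exact this
  -- `r ≡ rp` on `ℝ × ℝ` by transport, so the solution is forward-flat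
  have hrconst : ∀ q : ℝ × ℝ, r q = rp := by
    rintro ⟨z, x⟩
    obtain ⟨X, hX0, hX⟩ := exists_global_char hw1 hκd hκB hk₁ hW₁ z x
    have h := const_along (c := fun q => κ (w q)) hr1 hPDE1 hX z 0
    rw [hX0] at h
    rw [h, hρ]
  have hflat' : ∀ q, fderiv ℝ p q (0, 1) + κ (w q) * fderiv ℝ w q (0, 1) = 0 := by
    intro q
    rw [← hrD, show r = fun _ => rp from funext hrconst]
    simp
  exact pSystem_const_of_forward_flat hw1 hp1 hκd hsys1 hsys2 hκpos hκhi hk₁ hW₁ hgn hflat'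

end Summit.NavierStokesRegularity.NavierStokesRegularity.Theorems.PoloidalWindowDoorPoloidalWindowRigidityZShockTwoStates

end
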